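import Summits.BirchSwinnertonDyer.BirchSwinnertonDyer.Theorems.ByReductionTypeAtTwoKatoFreeSandwichAssembly
import Summits.BirchSwinnertonDyer.BirchSwinnertonDyer.Theorems.ByReductionTypeAtTwoOrdMissingLowerBoundOfLambdaHalf
import Summits.BirchSwinnertonDyer.BirchSwinnertonDyer.Theses.ByReductionTypeAtTwo
import Summits.BirchSwinnertonDyer.BirchSwinnertonDyer.Theses.TwoAdicConverse
import HarnessLib

/-!
# TRIAGE r1 seat 2/2, GEN 13 — crux `OrdMissingLowerBoundAtTwo` (stmt-BirchSwinnertonDyer-19577, K4 `ByReductionTypeAtTwo`):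
# the picked line `kato-free-lower-sandwich-two` consumes the λ-half 19556 ONLY ON ITS ANALYTIC-RANK-0 SLICE

Refuter crux-triage companion (crux WORKFILE: elaborates on the farm, no `sorry`; nothing proposed, no Literature fact,
no `@[route_item]`; the four `def`s are local to this namespace).  BSD is NOT proved by anything here; 19577 is NOT closed;
this seat LEADS nothing and ran no `ledger skeleton check`.

PRICING FINDING (joint-sufficiency read of the landed assembly p668589 and the lead g3 TURNKEY glue
`OrdMissingLowerBoundAtTwoOfInputs`).  The spine theorem
`KatoFreeSandwich.ordMissingLowerBoundAtTwo_of_lambdaHalf_of_analyticMuLEWitness` applies its hypothesis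
`hΛ : TwoAdicTwistConverse.OrdLambdaHalfAtTwo` (= crux 19556: the λ-inequality at EVERY non-CM good-ordinary-at-2
curve, ANY analytic rank) exactly once, as `hΛ W'' hcm'' hgo''` at a curve `W''` ISOGENOUS to the rank-0 input curve
`W` (so `W''.analyticRank = 0`, proved in the spine by `analyticRank_eq_of_isIsogenous'`).  Hence the line needs only

  `OrdLambdaHalfAtTwoRankZero := ∀ W, ¬CM → analyticRank W = 0 → GoodOrd W 2 → LambdaHalfAtTwo W`,

the RANK-0 SLICE of 19556 — STRICTLY FEWER instances than 19556 (which S3 `TwoAdicConverse` needs at UNKNOWN analytic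
rank, that being the point of a converse theorem).  Below: the slice (`def`), `19556 → slice` (one line, also from the
Theses spelling), the spine / selector / assembly re-threaded over the slice with the SAME proof terms as p652707 /
p668589 (only the λ-argument changes), and the TURNKEY-shaped glue over the slice closing the ROUTE DECL by name.
So: 19577 ⟸ PUB (19149) ∧ Cassels (19567.1) ∧ Abbes–Ullmo ∧ `X₁(N)`-optimal datum (T2) ∧ (19556 ↾ analytic rank 0).

Why not finer: `LambdaHalfAtTwo` is applied at the selected member `W''` (max-period member, or `W` itself when
`E(ℚ)[2] = 0`), but λ(X) and λ(L₂) are isogeny invariants (the `∃ c : ℚ` in `LambdaHalfAtTwo` absorbs the period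
ratio), so «slice at selected members» is not an honest weakening of «slice»; the rank-0 restriction is.

And not coarser either (last section): granted K4's OWN Kato crux 19573 `OrdKatoHalfAtTwoIso` + PUB + Cassels, 19577 gives
the slice back (`ordLambdaHalfAtTwoRankZero_of_katoHalfIso_of_missingLowerBound`, via ord-3 GEN 5's per-curve
`lambdaHalfAtTwo_of_katoHalf_of_missingLowerBoundAt`), so INSIDE K4 the crux 19577 and the slice are equivalent
(`ordMissingLowerBoundAtTwo_iff_lambdaHalfRankZero_inside_K4`): the slice is the exact research residual of 19577, and
P3's r212 = 19556 verbatim exceeds K4's need by precisely «19556 at analytic rank ≥ 1» (S3's own territory).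
-/

set_option autoImplicit false
set_option linter.dupNamespace false

noncomputable section

open scoped Classical MatrixGroups ModularForm

open CongruenceSubgroup WeierstrassCurve Literature.NumberTheory.EllipticCurves
  Literature.NumberTheory.EllipticCurves.ModularForms Literature.NumberTheory.EllipticCurves.Rank1Residual
  Literature.NumberTheory.EllipticCurves.Rank1Residual.Typed
  Literature.NumberTheory.EllipticCurves.Greenberg1999
  Summit.BirchSwinnertonDyer.Rank1Residual.X1.MuLambda
  Summit.BirchSwinnertonDyer.Rank1Residual.X1.MuPart
  Summit.BirchSwinnertonDyer.Rank1Residual.X5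
  Summit.BirchSwinnertonDyer.Rank1Residual.X5.O1
  Summit.BirchSwinnertonDyer.Rank1Residual
  Summit.BirchSwinnertonDyer.BirchSwinnertonDyer.Theorems.TwoAdicTwistConverse
  Summit.BirchSwinnertonDyer.BirchSwinnertonDyer.Theorems.EisensteinLowerBounds
  Summit.BirchSwinnertonDyer.BirchSwinnertonDyer.Theorems.EisensteinShaCurrency
  Summit.BirchSwinnertonDyer.BirchSwinnertonDyer.Theorems.IsogenyMuShift
  Summit.BirchSwinnertonDyer.BirchSwinnertonDyer.Theorems.KatoFreeSandwich

namespace Summit.BirchSwinnertonDyer.BirchSwinnertonDyer.Cruxes.OrdMissingLowerBoundAtTwo.TriageR1Seat2Gen13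

open Summit.BirchSwinnertonDyer.BirchSwinnertonDyer.Theorems
open Summit.BirchSwinnertonDyer.BirchSwinnertonDyer.Theses

/-- The ANALYTIC-RANK-0 SLICE of crux 19556 `OrdLambdaHalfAtTwo`: the λ-inequality `λ(L₂(E)) ≤ λ(X(E/ℚ_∞))`
(`TwoAdicTwistConverse.LambdaHalfAtTwo`) for every non-CM, analytic-rank-0, good-ordinary-at-2, globally minimal `W`.
This is all the K4 line `kato-free-lower-sandwich-two` consumes of 19556.  (Research-grade at `p = 2` like 19556 itself —
Eisenstein direction of IMC₂ ⊗ ℚ on rank-0 curves; nothing asserted.) -/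
def OrdLambdaHalfAtTwoRankZero : Prop :=
  ∀ (W : WeierstrassCurve ℚ) [W.IsElliptic] [W.IsGloballyMinimal], ¬ W.HasCM → W.analyticRank = 0 →
    GoodOrd W 2 → TwoAdicTwistConverse.LambdaHalfAtTwo W

/-- 19556 (Theorems spelling, as consumed by p668589) ⟹ its rank-0 slice. -/
theorem ordLambdaHalfAtTwoRankZero_of_ordLambdaHalfAtTwo
    (hΛ : TwoAdicTwistConverse.OrdLambdaHalfAtTwo) : OrdLambdaHalfAtTwoRankZero :=
  fun W _ _ hcm _ hgo => hΛ W hcm hgo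

/-- 19556 (Theses spelling `Theses.TwoAdicConverse.OrdLambdaHalfAtTwo`, the route decl of S3) ⟹ the slice. -/
theorem ordLambdaHalfAtTwoRankZero_of_theses
    (hΛ : TwoAdicConverse.OrdLambdaHalfAtTwo) : OrdLambdaHalfAtTwoRankZero :=
  fun W _ _ hcm _ hgo => hΛ W hcm hgo

/-- The spine `ordMissingLowerBoundAtTwo_of_lambdaHalf_of_analyticMuLEWitness` (p652707) RE-THREADED over the slice:
same proof term, the λ-hypothesis is now applied with the rank-0 witness `hr''`. -/
theorem ordMissingLowerBoundAtTwo_of_lambdaHalfRankZero_of_analyticMuLEWitness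
    (hPub : Literature.Uncategorized.OrdPublishedInputsAtTwo) (hCassels : bsdRHS_eq_of_isIsogenous)
    (hΛ0 : OrdLambdaHalfAtTwoRankZero)
    (hμ : ∀ (W : WeierstrassCurve ℚ) [W.IsElliptic] [W.IsGloballyMinimal], ¬ W.HasCM →
      W.analyticRank = 0 → GoodOrd W 2 →
      ∃ (W'' : WeierstrassCurve ℚ) (_ : W''.IsElliptic) (_ : W''.IsGloballyMinimal),
        IsIsogenous W W'' ∧ AnalyticMuLE W'' 2 0) :
    OrdHalvesAtTwo.OrdMissingLowerBoundAtTwo := by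
  have hPub' := hPub
  obtain ⟨hmod, hGZK, h17, hGr⟩ := hPub'
  intro W _ _ hcm hr hgo
  obtain ⟨W'', _, _, hiso'', hμ''⟩ := hμ W hcm hr hgo
  have hcm'' : ¬ W''.HasCM := fun h => hcm ((X12.hasCM_iff_of_isIsogenous hiso'').mpr h)
  have hr'' : W''.analyticRank = 0 := by rw [← analyticRank_eq_of_isIsogenous' hiso'']; exact hr
  have hgo'' : GoodOrd W'' 2 := isOrdinaryAt_of_isIsogenous hiso'' hgo
  exact missingLowerBoundAt_two_of_isIsogenous W hCassels hGZK hmod hr hiso''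
    (missingLowerBoundAt_two_of_lambdaHalf_of_analyticMuLE W'' hmod hGZK (h17 W'')
      (twoAdicEulerCharRankZero_zero_of_greenberg W'' hGr) hgo'' hr'' (hΛ0 W'' hcm'' hr'' hgo'') hμ'')

/-- The selector form `ordMissingLowerBoundAtTwo_of_lambdaHalf_of_selector` (p652707 §2) over the slice. -/
theorem ordMissingLowerBoundAtTwo_of_lambdaHalfRankZero_of_selector
    (P : ∀ (W W'' : WeierstrassCurve ℚ), Prop)
    (hPub : Literature.Uncategorized.OrdPublishedInputsAtTwo) (hCassels : bsdRHS_eq_of_isIsogenous)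
    (hAU : abbesUllmo_not_dvd_maninConstant_of_not_dvd_level)
    (hΛ0 : OrdLambdaHalfAtTwoRankZero)
    (hsel : ∀ (W : WeierstrassCurve ℚ) [W.IsElliptic] [W.IsGloballyMinimal],
      GoodOrd W 2 → (∃ x : ℚ, HasRationalTwoTorsionX W x) →
      ∃ (W'' : WeierstrassCurve ℚ) (_ : W''.IsElliptic) (_ : W''.IsGloballyMinimal), IsIsogenous W W'' ∧ P W W'')
    (hμP : ∀ (W W'' : WeierstrassCurve ℚ) [W.IsElliptic] [W.IsGloballyMinimal] [W''.IsElliptic] [W''.IsGloballyMinimal],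
      ¬ W.HasCM → W.analyticRank = 0 → GoodOrd W 2 → IsIsogenous W W'' →
      (∃ x : ℚ, HasRationalTwoTorsionX W x) → P W W'' → AnalyticMuLE W'' 2 0) :
    OrdHalvesAtTwo.OrdMissingLowerBoundAtTwo := by
  refine ordMissingLowerBoundAtTwo_of_lambdaHalfRankZero_of_analyticMuLEWitness hPub hCassels hΛ0 ?_
  intro W _ _ hcm hr hgo
  by_cases h2 : ∃ x : ℚ, HasRationalTwoTorsionX W x
  · obtain ⟨W'', hE, hM, hiso, hP⟩ := hsel W hgo h2
    exact ⟨W'', hE, hM, hiso, @hμP W W'' _ _ hE hM hcm hr hgo hiso h2 hP⟩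
  · push Not at h2
    exact ⟨W, ‹_›, ‹_›, isIsogenous_self W, analyticMuLE_two_zero_of_noRationalTwoTorsion_of_abbesUllmo W hAU hgo h2⟩

/-- The line ASSEMBLED over the slice: same composition as p668589
`ordMissingLowerBoundAtTwo_of_published_of_lambdaHalf` — selector = «2-adically maximal real period in the class»
(`stub_maxPeriodWitness`, p653776), S2/S3 + flat witness (W) at every odd level (p660532, p665962), (β) via the
`X₁(N)`-optimal datum (p667647) — with the λ-input weakened to the rank-0 slice.
[cite: Kato2004Asterisque, Thm. 17.4] [cite: Stevens1989, §2] -/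
theorem ordMissingLowerBoundAtTwo_of_published_of_lambdaHalfRankZero
    (hPub : Literature.Uncategorized.OrdPublishedInputsAtTwo) (hCassels : bsdRHS_eq_of_isIsogenous)
    (hAU : abbesUllmo_not_dvd_maninConstant_of_not_dvd_level)
    (hex : exists_optimal_gamma1ParametrizationData)
    (hΛ0 : OrdLambdaHalfAtTwoRankZero) :
    OrdHalvesAtTwo.OrdMissingLowerBoundAtTwo := by
  have hnf : exists_isNewformOf := exists_isNewformOf_of_nonempty_modularParametrizationData hPub.1
  exact ordMissingLowerBoundAtTwo_of_lambdaHalfRankZero_of_selector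
    (fun _ W'' => ∀ (W₃ : WeierstrassCurve ℚ) [W₃.IsElliptic] [W₃.IsGloballyMinimal], IsIsogenous W'' W₃ →
      ∀ q : ℚ, W₃.realPeriodRat = (q : ℝ) * W''.realPeriodRat → padicValRat 2 q ≤ 0)
    hPub hCassels hAU hΛ0
    (fun W _ _ _ _ => stub_maxPeriodWitness W)
    (fun W W'' _ _ _ _ =>
      stubAtMaxPeriod_of_periodDescentOfMeasureDepth hnf hAU
        (AnalyticMuTwo.periodDescentOfMeasureDepth_of_flatWitness_of_eisensteinDescent
          FlatWitnessTwo.flatWitnessAtTwo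
          (AnalyticMuTwo.periodDescentOfEisenstein_of_gamma1Optimal hex hPub hAU)) W W'')

/-- TURNKEY-shaped glue over the SLICE (compare the lead g3's `OrdMissingLowerBoundAtTwoOfInputs`, whose fourth
hypothesis is the full 19556): PUB (19149) → iso-rider (19567) → ⟨AU ∧ T2⟩ → slice → ROUTE DECL. -/
def OrdMissingLowerBoundAtTwoOfInputsRankZero : Prop :=
  ByReductionTypeAtTwo.OrdPublishedInputsAtTwo → ByReductionTypeAtTwo.OrdIsoPublishedInputsAtTwo →
    (abbesUllmo_not_dvd_maninConstant_of_not_dvd_level ∧ exists_optimal_gamma1ParametrizationData) →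
    OrdLambdaHalfAtTwoRankZero → ByReductionTypeAtTwo.OrdMissingLowerBoundAtTwo

/-- CERTIFICATE: the slice glue closes at once (route decl `Theses.ByReductionTypeAtTwo.OrdMissingLowerBoundAtTwo` by name). -/
theorem ordMissingLowerBoundAtTwoOfInputsRankZero_closes : OrdMissingLowerBoundAtTwoOfInputsRankZero :=
  fun hPub hPubI hPr hΛ0 =>
    ordMissingLowerBoundAtTwo_of_published_of_lambdaHalfRankZero hPub hPubI.1 hPr.1 hPr.2 hΛ0

/-- …and the lead's glue shape (full 19556, Theses spelling) factors through the slice glue. -/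
theorem ordMissingLowerBoundAtTwo_of_inputs_via_slice
    (hOrdPub : ByReductionTypeAtTwo.OrdPublishedInputsAtTwo) (hOrdPubI : ByReductionTypeAtTwo.OrdIsoPublishedInputsAtTwo)
    (hOrdPr : abbesUllmo_not_dvd_maninConstant_of_not_dvd_level ∧ exists_optimal_gamma1ParametrizationData)
    (hΛ : TwoAdicConverse.OrdLambdaHalfAtTwo) :
    ByReductionTypeAtTwo.OrdMissingLowerBoundAtTwo :=
  ordMissingLowerBoundAtTwoOfInputsRankZero_closes hOrdPub hOrdPubI hOrdPr (ordLambdaHalfAtTwoRankZero_of_theses hΛ)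

/-! ## P3-shaped glue over the slice (pen RC-331, `plan/ordmlb-19577/`, not yet rendered at 21:45Z)

P3 files the glue support r213 `OrdMissingLowerBoundAtTwoOfLambdaHalf := OrdPublishedInputsAtTwo → OrdIsoPublishedInputsAtTwo →
OrdKatoIsoPrintedInputsAtTwo → OrdMLBPrintedInputsAtTwo → OrdLambdaHalfAtTwo → OrdMissingLowerBoundAtTwo` with r212
`OrdLambdaHalfAtTwo` = 19556 VERBATIM (any analytic rank).  Below, the SAME glue text with the two print items replaced by their
definientia (P2: `OrdKatoIsoPrintedInputsAtTwo := abbesUllmo_…` by name; P3: `OrdMLBPrintedInputsAtTwo := exists_optimal_…` by name —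
exactly as the pen's certificate `ClosingOrdMissingLowerBoundAtTwoOfLambdaHalf.lean` does) and r212 replaced by the RANK-0 SLICE:
it closes at once, and the pen's certificate theorem factors through it.  Pricing consequence only (the pen decides): r213's closing
proof consumes 19556 only through `OrdLambdaHalfAtTwoRankZero`. -/

/-- P3's glue text over the SLICE: PUB → iso-rider → Abbes–Ullmo → T2 → (19556 ↾ analytic rank 0) → ROUTE DECL. -/
def OrdMissingLowerBoundAtTwoOfLambdaHalfRankZero : Prop :=
  ByReductionTypeAtTwo.OrdPublishedInputsAtTwo → ByReductionTypeAtTwo.OrdIsoPublishedInputsAtTwo →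
    abbesUllmo_not_dvd_maninConstant_of_not_dvd_level → exists_optimal_gamma1ParametrizationData →
    OrdLambdaHalfAtTwoRankZero → ByReductionTypeAtTwo.OrdMissingLowerBoundAtTwo

/-- CERTIFICATE: P3's glue text over the slice closes at once. -/
theorem ordMissingLowerBoundAtTwoOfLambdaHalfRankZero_closes : OrdMissingLowerBoundAtTwoOfLambdaHalfRankZero :=
  fun hPub hIso hAU hT2 hΛ0 => ordMissingLowerBoundAtTwo_of_published_of_lambdaHalfRankZero hPub hIso.1 hAU hT2 hΛ0

/-- The pen certificate's theorem `ordMissingLowerBoundAtTwoOfLambdaHalf_text` (r213's text with r212 = 19556 verbatim, here in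
its `Iff.rfl`-equal Theses spelling `TwoAdicConverse.OrdLambdaHalfAtTwo`) FACTORS through the slice glue. -/
theorem ordMissingLowerBoundAtTwoOfLambdaHalf_text_via_slice :
    ByReductionTypeAtTwo.OrdPublishedInputsAtTwo → ByReductionTypeAtTwo.OrdIsoPublishedInputsAtTwo →
    abbesUllmo_not_dvd_maninConstant_of_not_dvd_level → exists_optimal_gamma1ParametrizationData →
    TwoAdicConverse.OrdLambdaHalfAtTwo → ByReductionTypeAtTwo.OrdMissingLowerBoundAtTwo :=
  fun hPub hIso hAU hT2 hLam =>
    ordMissingLowerBoundAtTwoOfLambdaHalfRankZero_closes hPub hIso hAU hT2 (ordLambdaHalfAtTwoRankZero_of_theses hLam)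

/-! ## The slice is the EXACT residual of 19577 inside K4 (modulo the route's own print and its Kato crux 19573)

K4 files the Kato half as crux 19573 `OrdKatoHalfAtTwoIso` (integral Kato divisibility at SOME member of each class).  Granted
PUB + Cassels + 19573, the descent inequality 19577 gives back the λ-half AT EVERY rank-0 good-ordinary non-CM curve — ord-3 GEN 5's
per-curve `EisensteinShaCurrency.lambdaHalfAtTwo_of_katoHalf_of_missingLowerBoundAt` (19577 ∧ Kato half ⇒ 2-adic IMC ⇒ λ-half), with
the Kato half moved to the curve itself by `katoHalf_isogenyInvariant`.  Together with the line (previous sections, which do NOT use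
19573): modulo {PUB, Cassels, Abbes–Ullmo, T2, 19573} the K4 crux 19577 and the rank-0 slice of 19556 are ONE statement.  So P3's
r212 = 19556 (all analytic ranks) exceeds what K4's good-ordinary conjunct needs by exactly «19556 at analytic rank ≥ 1». -/

/-- **19573 ∧ 19577 ⟹ the slice** (PRINT: PUB, Cassels).  [cite: Kato2004Asterisque, Thm. 17.4 (1)(2) (p. 273)]
[cite: GreenbergLNM1716, Thm. 4.1 (p. 102)] [cite: MilneADT2006, Thm. I.7.3] -/
theorem ordLambdaHalfAtTwoRankZero_of_katoHalfIso_of_missingLowerBound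
    (hPub : Literature.Uncategorized.OrdPublishedInputsAtTwo) (hCassels : bsdRHS_eq_of_isIsogenous)
    (hK : ByReductionTypeAtTwo.OrdKatoHalfAtTwoIso) (hL : ByReductionTypeAtTwo.OrdMissingLowerBoundAtTwo) :
    OrdLambdaHalfAtTwoRankZero := by
  have hPub' := hPub
  obtain ⟨hmod, hGZK, h17, hGr⟩ := hPub'
  intro W _ _ hcm hr hgo
  obtain ⟨W', _, _, hiso', hK'⟩ := hK W hcm hr hgo
  have hKW : MainConjectureLowerDivisibilityAtTwoOrd W := katoHalf_isogenyInvariant hPub hCassels hiso' hgo hr hK'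
  exact lambdaHalfAtTwo_of_katoHalf_of_missingLowerBoundAt W hmod hGZK (h17 W)
    (twoAdicEulerCharRankZero_zero_of_greenberg W hGr) hgo hr hKW (hL W hcm hr hgo)

/-- **Inside K4, 19577 ⟺ the rank-0 slice of 19556** — modulo the route's print {PUB (19149), Cassels (19567.1), Abbes–Ullmo,
T2} and its Kato crux 19573.  (⇐ is the line and does not use 19573; ⇒ is the previous theorem and does not use AU/T2.) -/
theorem ordMissingLowerBoundAtTwo_iff_lambdaHalfRankZero_inside_K4
    (hPub : ByReductionTypeAtTwo.OrdPublishedInputsAtTwo) (hIso : ByReductionTypeAtTwo.OrdIsoPublishedInputsAtTwo)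
    (hAU : abbesUllmo_not_dvd_maninConstant_of_not_dvd_level) (hT2 : exists_optimal_gamma1ParametrizationData)
    (hK : ByReductionTypeAtTwo.OrdKatoHalfAtTwoIso) :
    ByReductionTypeAtTwo.OrdMissingLowerBoundAtTwo ↔ OrdLambdaHalfAtTwoRankZero :=
  ⟨ordLambdaHalfAtTwoRankZero_of_katoHalfIso_of_missingLowerBound hPub hIso.1 hK,
    ordMissingLowerBoundAtTwoOfLambdaHalfRankZero_closes hPub hIso hAU hT2⟩

end Summit.BirchSwinnertonDyer.BirchSwinnertonDyer.Cruxes.OrdMissingLowerBoundAtTwo.TriageR1Seat2Gen13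

end
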